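import Summits.QuantumAdvantage.QuantumAdvantage.Theorems.NearExactIsExact.Negative.TypeOSixtyOneFourteen

/-!
# The tight type-O ("type T") configuration at `Φ = 61/64` on 14 bits (NearExactIsExact, disprover gen 24)

Negative/structural lemmas for the crux `CubicForrelation.NearExactIsExact` (item r2), finite slice `n = 14`.
HONEST FRAMING: statements about cubic Boolean functions on 14 bits — NOT summit progress; no violation of `NearExactIsExact`.

Setting: `g` cubic of TYPE O (`W_g = 32u`, all `u(x)` odd), digits `d₁ = [⌊u/2⌋ odd]`, `d₂ = [⌊u/4⌋ odd]`, `E = {d₁ = d₂}`,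
residual `F = u − 4(−1)^f`.
* `tt_tight`: if `Φ(f,g) ≥ 61/64` (with `f` cubic) then the budget inequality of `…Negative.TypeOSixtyOneFourteen` is an equality:
  `#E = 2¹⁰`, `F² = 1 + 8·1_E` pointwise, and `Φ = 61/64` exactly.
* `tt_decode_pt` / `tt_decode`: the pointwise equality decodes to `F = (1 − 2d₁)(1 − 4·1_E) ∈ {±1, ±3}`; hence
  `u ≡ 5 − 2d₁ − 4·1_E (mod 8)` (`tt_mod_eight`).
* `tt_dual`: if the partner is also divisible by `32` (`W_f = 32v`) then `F̂ = −128·(v − 4(−1)^g)` (Fourier inversion).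
These feed the period/Pfaffian analysis of `…Negative.PfaffianPeriodFourteen` and `…Negative.TypeTFalseFourteen`.
Sources: [this work]; tools from the tree as cited inline.  Standard axioms only.
-/

set_option linter.dupNamespace false -- D-0017: single-problem summit ⇒ `QuantumAdvantage.QuantumAdvantage` by design

noncomputable section

namespace Summit.QuantumAdvantage.QuantumAdvantage.Theorems.NearExactIsExact.Negative.TightTypeTFourteen

open Finset
open Literature.Computability.QuantumComplexity
open Literature.Computability.QuantumComplexity.DerivativeWalsh (W)
open Summit.QuantumAdvantage.QuantumAdvantage.Theorems.CubicForrelation.NearExactIsExact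
open Summit.QuantumAdvantage.QuantumAdvantage.Theorems.NearExactIsExact.Negative.CaseAFrameFreeFourteen
  (caseA_forrelation_le)

set_option maxHeartbeats 800000 in
/-- **Tightness at `61/64`.**  For cubic `f, g` on 14 bits with `g` of type O (`W_g = 32u`, all `u(x)` odd) and `Φ(f,g) ≥ 61/64`:
`#E = 1024`, `(u − 4(−1)^f)² = 1 + 8·1_E` pointwise, and `Φ(f,g) = 61/64`.  (Equality case of `to61_E_nonempty_le`; `E = ∅` is
excluded by `caseA_forrelation_le`.)  NOT summit progress. [this work] -/
theorem tt_tight (f g : (Fin (7 + 7) → Bool) → Bool) (hf : IsDegLeFun 3 f) (hg : IsDegLeFun 3 g)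
    (u : (Fin (7 + 7) → Bool) → ℤ) (hu : ∀ x, W (fun y => signOf (g y)) x = (2 : ℝ) ^ 5 * (u x : ℝ))
    (hodd : ∀ x, Odd (u x)) (hΦ : (61 / 64 : ℝ) ≤ forrelation f g) :
    #(univ.filter fun x : Fin (7 + 7) → Bool => (Odd (u x / 2) ↔ Odd (u x / 2 / 2))) = 1024 ∧
    (∀ x, (u x - 4 * sZ (f x)) ^ 2 = 1 + 8 * (if (Odd (u x / 2) ↔ Odd (u x / 2 / 2)) then 1 else 0 : ℤ)) ∧
    forrelation f g = 61 / 64 := by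
  classical
  have hEne : ∃ x, (Odd (u x / 2) ↔ Odd (u x / 2 / 2)) := by
    by_contra h
    have hA := caseA_forrelation_le f g hf hg u hu hodd fun x hx => h ⟨x, hx⟩
    linarith
  have hd1 : IsDegLeFun 2 (fun x => decide (Odd (u x / 2))) := fd_digitOne g u hg hu
  have hd2 : IsDegLeFun 4 (fun x => decide (Odd (u x / 2 / 2))) := fd_digitTwo g u hg hu
  set E := univ.filter (fun x : Fin (7 + 7) → Bool => (Odd (u x / 2) ↔ Odd (u x / 2 / 2))) with hEdef
  have hdegE : IsDegLeFun 4 (fun x => (decide (Odd (u x / 2)) ^^ decide (Odd (u x / 2 / 2))) ^^ true) :=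
    tb_isDegLeFun_xor_const (bb_isDegLeFun_bxor (hd1.mono (by norm_num)) hd2) true
  have hsetE : (univ.filter fun x : Fin (7 + 7) → Bool =>
      ((decide (Odd (u x / 2)) ^^ decide (Odd (u x / 2 / 2))) ^^ true) = true) = E := by
    rw [hEdef]
    apply filter_congr
    intro x _
    by_cases h1 : Odd (u x / 2) <;> by_cases h2 : Odd (u x / 2 / 2) <;> simp [h1, h2]
  have hne : ∃ x, ((decide (Odd (u x / 2)) ^^ decide (Odd (u x / 2 / 2))) ^^ true) = true := by
    obtain ⟨x, hx⟩ := hEne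
    refine ⟨x, ?_⟩
    by_cases h1 : Odd (u x / 2) <;> by_cases h2 : Odd (u x / 2 / 2) <;> simp [h1, h2] at hx ⊢
  have hrm := bb_rmWeight_holds (7 + 7) 4 _ hdegE hne
  rw [hsetE] at hrm
  have hEge : 1024 ≤ #E := by norm_num at hrm; omega
  have hbud := fl_budget5 f g u hu
  have hsumE : (∑ x, (if (Odd (u x / 2) ↔ Odd (u x / 2 / 2)) then 1 else 0 : ℤ)) = #E := by rw [sum_boole]
  have hpt : ∀ x, 1 + 8 * (if (Odd (u x / 2) ↔ Odd (u x / 2 / 2)) then 1 else 0 : ℤ) ≤ (u x - 4 * sZ (f x)) ^ 2 :=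
    fun x => tw12_pt (u x) (sZ (f x)) (hodd x) (tp_sZ_cases (f x))
  have hBle : (∑ x, (u x - 4 * sZ (f x)) ^ 2 : ℤ) ≤ 24576 := by
    have : ((∑ x, (u x - 4 * sZ (f x)) ^ 2 : ℤ) : ℝ) ≤ 24576 := by rw [hbud]; linarith
    exact_mod_cast this
  have hEge' : (1024 : ℤ) ≤ #E := by exact_mod_cast hEge
  have hlow : ∑ x, (1 + 8 * (if (Odd (u x / 2) ↔ Odd (u x / 2 / 2)) then 1 else 0 : ℤ)) = 16384 + 8 * #E := by
    rw [sum_add_distrib, ← mul_sum, hsumE, sum_const, card_univ, Fintype.card_fun, Fintype.card_bool, Fintype.card_fin]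
    norm_num
  have hsumle : ∑ x, ((u x - 4 * sZ (f x)) ^ 2 - (1 + 8 * (if (Odd (u x / 2) ↔ Odd (u x / 2 / 2)) then 1 else 0 : ℤ))) ≤ 0 := by
    rw [sum_sub_distrib, hlow]
    linarith
  have hz : ∀ x ∈ (univ : Finset (Fin (7 + 7) → Bool)),
      ((u x - 4 * sZ (f x)) ^ 2 - (1 + 8 * (if (Odd (u x / 2) ↔ Odd (u x / 2 / 2)) then 1 else 0 : ℤ))) = 0 :=
    (sum_eq_zero_iff_of_nonneg fun x _ => by linarith [hpt x]).1
      (le_antisymm hsumle (sum_nonneg fun x _ => by linarith [hpt x]))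
  have hzs : ∑ x, ((u x - 4 * sZ (f x)) ^ 2 - (1 + 8 * (if (Odd (u x / 2) ↔ Odd (u x / 2 / 2)) then 1 else 0 : ℤ))) = 0 :=
    sum_eq_zero hz
  rw [sum_sub_distrib, hlow] at hzs
  have hEcard : #E = 1024 := by
    have h1 : (#E : ℤ) ≤ 1024 := by linarith
    have h2 : #E ≤ 1024 := by exact_mod_cast h1
    omega
  refine ⟨hEcard, fun x => by linarith [hz x (mem_univ _)], ?_⟩
  have hBeq : (∑ x, (u x - 4 * sZ (f x)) ^ 2 : ℤ) = 24576 := by rw [hEcard] at hzs; push_cast at hzs; linarith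
  have hR : ((∑ x, (u x - 4 * sZ (f x)) ^ 2 : ℤ) : ℝ) = 24576 := by exact_mod_cast hBeq
  rw [hbud] at hR
  linarith

/-- **Decoding the tight residual (pure arithmetic).**  For odd `v` and `s = ±1` with `(v − 4s)² = 1 + 8·[d₁ = d₂]`
(`d₁ = [⌊v/2⌋ odd]`, `d₂ = [⌊v/4⌋ odd]`): `v − 4s = (1 − 2d₁)(1 − 4·[d₁ = d₂])`.  NOT summit progress. [this work] -/
theorem tt_decode_pt (v s : ℤ) (hv : Odd v) (hs : s = 1 ∨ s = -1)
    (h : (v - 4 * s) ^ 2 = 1 + 8 * (if (Odd (v / 2) ↔ Odd (v / 2 / 2)) then 1 else 0 : ℤ)) :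
    v - 4 * s = (1 - 2 * (if Odd (v / 2) then 1 else 0 : ℤ)) *
      (1 - 4 * (if (Odd (v / 2) ↔ Odd (v / 2 / 2)) then 1 else 0 : ℤ)) := by
  have hb : (v - 4 * s) ^ 2 ≤ 9 := by rw [h]; split_ifs <;> norm_num
  have hlo : -3 ≤ v - 4 * s := by nlinarith
  have hhi : v - 4 * s ≤ 3 := by nlinarith
  rw [Int.odd_iff] at hv
  rcases hs with rfl | rfl
  · have h1 : 1 ≤ v := by omega
    have h7 : v ≤ 7 := by omega
    interval_cases v <;> first | omega | norm_num [Int.odd_iff]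
  · have h1 : -7 ≤ v := by omega
    have h7 : v ≤ -1 := by omega
    interval_cases v <;> first | omega | norm_num [Int.odd_iff]

/-- **Decoded residual of a tight type-O side.**  Under the conclusion of `tt_tight`: `u − 4(−1)^f = (1 − 2d₁)(1 − 4·1_E)` pointwise.
NOT summit progress. [this work] -/
theorem tt_decode (f : (Fin (7 + 7) → Bool) → Bool) (u : (Fin (7 + 7) → Bool) → ℤ) (hodd : ∀ x, Odd (u x))
    (hpt : ∀ x, (u x - 4 * sZ (f x)) ^ 2 = 1 + 8 * (if (Odd (u x / 2) ↔ Odd (u x / 2 / 2)) then 1 else 0 : ℤ))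
    (x : Fin (7 + 7) → Bool) :
    u x - 4 * sZ (f x) = (1 - 2 * (if Odd (u x / 2) then 1 else 0 : ℤ)) *
      (1 - 4 * (if (Odd (u x / 2) ↔ Odd (u x / 2 / 2)) then 1 else 0 : ℤ)) :=
  tt_decode_pt (u x) (sZ (f x)) (hodd x) (tp_sZ_cases (f x)) (hpt x)

/-- **`u ≡ 5 − 2d₁ − 4·1_E (mod 8)`** on a tight type-O side (from `tt_decode`, `4(−1)^f ≡ 4`).  NOT summit progress. [this work] -/
theorem tt_mod_eight (f : (Fin (7 + 7) → Bool) → Bool) (u : (Fin (7 + 7) → Bool) → ℤ) (hodd : ∀ x, Odd (u x))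
    (hpt : ∀ x, (u x - 4 * sZ (f x)) ^ 2 = 1 + 8 * (if (Odd (u x / 2) ↔ Odd (u x / 2 / 2)) then 1 else 0 : ℤ))
    (x : Fin (7 + 7) → Bool) :
    (8 : ℤ) ∣ u x - 5 + 2 * (if decide (Odd (u x / 2)) = true then 1 else 0 : ℤ) +
      4 * (if decide (Odd (u x / 2) ↔ Odd (u x / 2 / 2)) = true then 1 else 0 : ℤ) := by
  have h := tt_decode f u hodd hpt x
  simp only [decide_eq_true_iff]
  rcases tp_sZ_cases (f x) with hs | hs <;> rw [hs] at h <;>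
    by_cases h1 : Odd (u x / 2) <;> by_cases h2 : Odd (u x / 2 / 2) <;>
    simp only [h1, h2, if_true, if_false, iff_true, iff_false, not_true] at h ⊢ <;>
    omega

/-- **Sign duality `F̂ = −128F'`.**  If `W_g = 32u` and `W_f = 32v` then the transform of `F = u − 4(−1)^f` is
`−128(v − 4(−1)^g)` (Fourier inversion `Σ_x W_g(x)(−1)^{x·y} = 2¹⁴(−1)^{g(y)}`).  NOT summit progress. [this work] -/
theorem tt_dual (f g : (Fin (7 + 7) → Bool) → Bool)
    (u : (Fin (7 + 7) → Bool) → ℤ) (hu : ∀ x, W (fun y => signOf (g y)) x = (2 : ℝ) ^ 5 * (u x : ℝ))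
    (v : (Fin (7 + 7) → Bool) → ℤ) (hv : ∀ y, W (fun x => signOf (f x)) y = (2 : ℝ) ^ 5 * (v y : ℝ))
    (y : Fin (7 + 7) → Bool) :
    W (fun x => ((u x - 4 * sZ (f x) : ℤ) : ℝ)) y = -128 * ((v y - 4 * sZ (g y) : ℤ) : ℝ) := by
  have hinv : ∑ x, (u x : ℝ) * twist x y = 512 * signOf (g y) := by
    have h := tz_inversion (fun z => signOf (g z)) y
    rw [sum_congr rfl fun x _ => by rw [hu x]] at h
    have e : ∑ x, (2 : ℝ) ^ 5 * (u x : ℝ) * twist x y = 2 ^ 5 * ∑ x, (u x : ℝ) * twist x y := by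
      rw [mul_sum]
      exact sum_congr rfl fun x _ => by ring
    rw [e] at h
    have h' : (2 : ℝ) ^ 5 * (∑ x, (u x : ℝ) * twist x y - 512 * signOf (g y)) = 0 := by
      rw [mul_sub, h]; ring
    have h2 : (2 : ℝ) ^ 5 ≠ 0 := by positivity
    linarith [(mul_eq_zero.1 h').resolve_left h2]
  have hvy := hv y
  unfold W at hvy ⊢
  have e : ∀ x, ((u x - 4 * sZ (f x) : ℤ) : ℝ) * twist x y = (u x : ℝ) * twist x y - 4 * (signOf (f x) * twist x y) := by
    intro x
    push_cast
    rw [tp_sZ_cast]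
    ring
  rw [sum_congr rfl fun x _ => e x, sum_sub_distrib, ← mul_sum, hinv, hvy]
  push_cast
  rw [tp_sZ_cast]
  ring

end Summit.QuantumAdvantage.QuantumAdvantage.Theorems.NearExactIsExact.Negative.TightTypeTFourteen

end
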